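/-
Copyright (c) 2026 the pub-hodgecm-mathlib formalisation cell (harness21).  Prover seat hodgecm-mathlib-LH4-p01 (g0): line LH4, SHALIKA pay-down, organ ‹RAO›
(RAO-CONV, holder F0P3a-p09 (g4)); dealer LH4-plan (g2) DEALER WORDS #16 (b) «RAO-TRANSV-FRAME»; 2026-09-02.
-/
import Literature.NumberTheory.Automorphic.UnitaryThreeUnipotentCentralizers        -- ★ `exists_coe_eq_torus_mul_upperUnipotent_of_commute`, `torus_mul_upperUnipotent_commute_cornerUnipotent`, `diagonal_mem_unitaryGroupOfForm_three_iff`; brings ★ `UnitaryThreeSingularUnipotentClasses` (`n(t)`, `d(z)`)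
import Literature.NumberTheory.Automorphic.HyperspecialUnitaryIwasawa               -- ★ `exists_eq_unitaryInt_mul_upper` (field-level Iwasawa `U = K₀·B`)
import Literature.NumberTheory.Automorphic.IntMatrixLevelConjugation                -- ★ `forall_v_conj_sub_one_apply_le_iff` (`GL₃(𝒪)`-conjugation preserves levels); brings `isIntMatrix_mul`, `isIntMatrix_diagonal_three`
import Literature.NumberTheory.Automorphic.UnitaryThreeRegularUnipotentClass          -- ★ `exists_units_coe_eq_upperTriangularUnipotent`
import Literature.NumberTheory.Automorphic.UnitaryThreeRegularUnipotentOrbitFrame     -- ★ p849269 (LH4-p02 (g2)) RAO-REG-FRAME: `coe_torusElt_zpow` (shared torus `d(z)`, reused BY NAME)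
import HarnessLib

/-!
# The ORBIT FRAME of a transvection `n(t)` in `U(σ, J₀)(K)`: `g = k · d(z)^j · c` (`k` integral unitary, `d(z)` the torus uniformiser, `c ∈ C(n(t))`) and the level of
# `g n(t) g⁻¹` is `|N(z)^j t|` (Rogawski 1990 §3.9, §4.9; Rao 1972)

Topic `NumberTheory/Automorphic`; namespace `Literature.NumberTheory.Automorphic.UnitaryGroup`.  THEOREMS ONLY (no definition, no instance, no notation, no named fact, no `sorry`);
kernel lane `--supports stmt-HodgeConjecture-24833`.  Cell `pub/hodgecm-mathlib` (D-0151), crux H413 = `stmt-HodgeConjecture-24833`; line LH4, SHALIKA pay-down of the print row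
`stub_N6nsShalika`, organ ‹RAO› (the Ranga-Rao clause of `stub_ShRao`: integrability of `C_c^∞` functions along the unipotent orbits), road (α′) of the holder F0P3a-p09 (g4)
(memo `F0/P3a/F0P3a-p09/g4/rao/RAO-CONV.census.F0P3ap09g4.md` 476bb72b §2 (I) «covering» for the TRANSVECTION classes); dealer LH4-plan (g2) DEALER WORDS #16 (b)
«RAO-TRANSV-FRAME» — the FIELD-LEVEL half (the carrier ∕ measure half (II)–(IV) is the holder's; he transports along ★ `localNonsplitEquiv` as ★ RANK ∕ U3-STRATA do).

SETTING: a field `K`, `σ : K →+* K` (an involution `hσ` where stated), `U(σ, J₀) = unitaryGroupOfForm σ ((StdForm.antidiagonal 3).over K) ≤ GL₃(K)`; the base point `n(t) = 1 + t·E₀₂`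
(`(u : Matrix) = !![1, 0, t; 0, 1, 0; 0, 0, 1]`; `n(t) ∈ U(σ, J₀)` iff `σt + t = 0`, ★ `mem_unitaryGroupOfForm_iff_of_coe_eq_cornerUnipotent` — not needed by the statements here); the
torus element `d(z) = diag(z, 1, (σz)⁻¹)` (★ `exists_units_coe_eq_torusElt`, ★ `torusElt_mem_unitaryGroupOfForm`); in §2 `[Valued K ℤᵐ⁰]`, `hvσ : |σa| = |a|`, `|z| = exp(−1)`
(a uniformiser, ANY ramification), integrality in the ★ `IsIntMatrix` currency (entries of valuation `≤ 1`; = the carrier dictionary ★ `mem_cmLocalIntegralLevel_iff_isIntMatrix_conj`).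

THE MATHEMATICS ([Rogawski1990, §3.9 «`G_u = S·N`», §4.5 Iwasawa `G = KB`]; the set-theoretic skeleton of [Rao1972]'s convergence argument for a transvection orbit): the
centraliser of `n(t)` in `U(σ, J₀)` is `S·N`, `S = {diag(α, β, α)}` (★ `exists_coe_eq_torus_mul_upperUnipotent_of_commute`); by Iwasawa (★ `exists_eq_unitaryInt_mul_upper`) every `g`
is `k₀ b`, `k₀ ∈ K₀ = U ∩ GL₃(𝒪)`, `b` upper triangular unitary, and `b = diag(α, β, (σα)⁻¹)·n₁` with `σβ·β = 1`, `n₁ ∈ N` (§1); writing `α = α₀ z^j`, `|α₀| = 1`, gives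
`g = (k₀ d(α₀)) · d(z)^j · (diag(1, β, 1) n₁)` with `k₀ d(α₀) ∈ K₀` and `diag(1, β, 1) n₁ ∈ C(n(t))` — (T3).  Along such a frame `g n(t) g⁻¹ = k · n(N(z)^j t) · k⁻¹` (the torus
scales `t` by norms, (T2)), and `GL₃(𝒪)`-conjugation preserves the entry levels of `X − 1` (★ `forall_v_conj_sub_one_apply_le_iff`), so «all entries of `g n(t) g⁻¹ − 1` are `≤ r`»
iff `|N(z)^j t| ≤ r` — (T4), the «bounded below in `j`» clause of the covering `{g | g n(t) g⁻¹ ∈ C} ⊆ ⋃_{j ≥ −m_C} K₀ d(z)^j C(n(t))`.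

* §1 (any field): `diagOneMid_mem_unitaryGroupOfForm_and_commute` (T1a), `mul_eq_mul_of_coe_eq_upperUnipotent` (T1b: `N ⊆ C(n(t))`), `coe_torusElt_inv` (with ★ `coe_torusElt_zpow` of LH4-p02's RAO-REG-FRAME p849269 reused BY NAME),
  **`coe_torusElt_zpow_conj_cornerUnipotent`** (T2), `exists_coe_eq_diagonal_mul_upperUnipotent_of_blockTriangular` (the Borel factor);
* §2 (`Valued`): `exists_v_eq_v_zpow`, **`exists_eq_int_mul_torusElt_zpow_mul_of_commute`** (T3, the covering), **`forall_v_conj_cornerUnipotent_sub_one_apply_le_iff`** (T4, the level).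
Index data (T7) are NOT typed here: the holder's road (α′) §2 (III) needs no residue-field cardinalities for the transvection classes (growth by strict containment).

HONEST LABEL: HC_CM is proved only modulo the 7 printed citations (2 remaining named inputs: hLiu418 = stmt-HodgeConjecture-24832, h413 = stmt-HodgeConjecture-24833) until
rung 0 closes; in-house matrix algebra over a valued field, count-neutral (the organ `stub_ShRao` and the print row `stub_N6nsShalika` move only at the desk's TIE).

## References
* [Rogawski1990] J. D. Rogawski, *Automorphic Representations of Unitary Groups in Three Variables*, Ann. of Math. Stud. 123 (1990): §1.10 p. 9 (`M`, `N`, `n(t)`), §3.9 p. 32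
  («`G_u = S·N`»), §4.5 p. 45 (Iwasawa decomposition), §4.9 p. 54 (unipotent orbital integrals).
* [Rao1972] R. Ranga Rao, *Orbital integrals in reductive groups*, Ann. of Math. (2) 96 (1972), 505–510 (convergence of unipotent orbital integrals).
* [Serre1979] J.-P. Serre, *Local Fields*, GTM 67 (1979), Ch. II §1 (discrete valuations, uniformisers).
* [BruhatTits1972] F. Bruhat, J. Tits, *Groupes réductifs sur un corps local I*, Publ. Math. IHÉS 41 (1972), (4.4.3) (Iwasawa decomposition).
-/

set_option autoImplicit false

noncomputable section

open scoped Valued WithZero Matrix MatrixGroups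
open Matrix

namespace Literature.NumberTheory.Automorphic.UnitaryGroup

open Literature.NumberTheory.Automorphic Literature.NumberTheory.Automorphic.HermitianLattice Literature.NumberTheory.Automorphic.UnitaryLatticeTree

variable {K : Type*} [Field K] (σ : K →+* K)

/-! ## §1 Algebra over any field: the centraliser pieces, the torus powers, the Borel factor -/

/-- `diag(1, β, 1)` with `σβ·β = 1` lies in `U(σ, J₀)` and commutes with `n(t)`. [cite: Rogawski1990, §3.9 p. 32] -/
theorem diagOneMid_mem_unitaryGroupOfForm_and_commute {β : K} (hβ : σ β * β = 1) {m : GL (Fin 3) K}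
    (hm : (m : Matrix (Fin 3) (Fin 3) K) = Matrix.diagonal ![1, β, 1]) {t : K} {u : GL (Fin 3) K}
    (hu : (u : Matrix (Fin 3) (Fin 3) K) = !![1, 0, t; 0, 1, 0; 0, 0, 1]) :
    m ∈ unitaryGroupOfForm σ ((StdForm.antidiagonal 3).over K) ∧ m * u = u * m := by
  refine ⟨(diagonal_mem_unitaryGroupOfForm_three_iff σ hm).2 ⟨by rw [map_one, one_mul], hβ, by rw [map_one, one_mul]⟩, Units.ext ?_⟩
  have h := torus_mul_upperUnipotent_commute_cornerUnipotent (1 : K) β 0 0 0 t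
  have h1 : (!![1, 0, 0; 0, 1, 0; 0, 0, 1] : Matrix (Fin 3) (Fin 3) K) = 1 := by
    ext i j; fin_cases i <;> fin_cases j <;> rfl
  rw [h1, Matrix.mul_one] at h
  rw [Units.val_mul, Units.val_mul, hm, hu]
  exact h

/-- An upper unitriangular matrix commutes with `n(t)` (`n(t)` is central in `N`). [cite: Rogawski1990, §3.9 p. 32] -/
theorem mul_eq_mul_of_coe_eq_upperUnipotent {x y c t : K} {n u : GL (Fin 3) K} (hn : (n : Matrix (Fin 3) (Fin 3) K) = !![1, x, y; 0, 1, c; 0, 0, 1])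
    (hu : (u : Matrix (Fin 3) (Fin 3) K) = !![1, 0, t; 0, 1, 0; 0, 0, 1]) : n * u = u * n := by
  refine Units.ext ?_
  have h := torus_mul_upperUnipotent_commute_cornerUnipotent (1 : K) 1 x y c t
  have h1 : (Matrix.diagonal ![(1 : K), 1, 1]) = 1 := by
    rw [← Matrix.diagonal_one]; congr 1; funext i; fin_cases i <;> rfl
  rw [h1, Matrix.one_mul] at h
  rw [Units.val_mul, Units.val_mul, hn, hu]
  exact h

/-- The inverse of the torus element: `d(z)⁻¹ = d(z⁻¹)`. [cite: Rogawski1990, §1.10 p. 9] -/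
theorem coe_torusElt_inv {z : K} (hz : z ≠ 0) {d : GL (Fin 3) K} (hd : (d : Matrix (Fin 3) (Fin 3) K) = Matrix.diagonal ![z, 1, (σ z)⁻¹]) :
    ((d⁻¹ : GL (Fin 3) K) : Matrix (Fin 3) (Fin 3) K) = Matrix.diagonal ![z⁻¹, 1, σ z] := by
  have hσz : σ z ≠ 0 := (map_ne_zero σ).2 hz
  rw [Matrix.coe_units_inv, hd]
  refine Matrix.inv_eq_left_inv ?_
  rw [Matrix.diagonal_mul_diagonal, ← Matrix.diagonal_one]
  congr 1; funext i; fin_cases i <;> simp [inv_mul_cancel₀ hz, mul_inv_cancel₀ hσz]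

/-- **(T2) TORUS SCALING**: `d(z)^j · n(t) · d(z)^{−j} = n(N(z)^j · t)`, `N(z) = z·σz` (★ `coe_torusElt_conj_cornerUnipotent` at `z^j`). [cite: Rogawski1990, §3.9 p. 32] -/
theorem coe_torusElt_zpow_conj_cornerUnipotent {z : K} (hz : z ≠ 0) {d : GL (Fin 3) K} (hd : (d : Matrix (Fin 3) (Fin 3) K) = Matrix.diagonal ![z, 1, (σ z)⁻¹])
    {t : K} {u : GL (Fin 3) K} (hu : (u : Matrix (Fin 3) (Fin 3) K) = !![1, 0, t; 0, 1, 0; 0, 0, 1]) (j : ℤ) :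
    ((d ^ j * u * (d ^ j)⁻¹ : GL (Fin 3) K) : Matrix (Fin 3) (Fin 3) K) = !![1, 0, (z * σ z) ^ j * t; 0, 1, 0; 0, 0, 1] := by
  have hzj : z ^ j ≠ 0 := zpow_ne_zero j hz
  have hdj : ((d ^ j : GL (Fin 3) K) : Matrix (Fin 3) (Fin 3) K) = Matrix.diagonal ![z ^ j, 1, (σ (z ^ j))⁻¹] := by
    rw [coe_torusElt_zpow σ hz hd j, map_zpow₀]
  rw [coe_torusElt_conj_cornerUnipotent σ hzj hdj (coe_torusElt_inv σ hzj hdj) hu, mul_zpow, map_zpow₀]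

/-- **The Borel factor of `U(σ, J₀)`**: an upper triangular `b ∈ U(σ, J₀)` is `diag(α, β, (σα)⁻¹) · n` with `σβ·β = 1` and `n` upper unitriangular (unitarity:
`B₀(b e₀, b e₂) = σb₀₀·b₂₂ = 1`, `B₀(b e₁, b e₁) = σb₁₁·b₁₁ = 1`). [cite: Rogawski1990, §1.10 p. 9; §4.5 p. 45] -/
theorem exists_coe_eq_diagonal_mul_upperUnipotent_of_blockTriangular {b : GL (Fin 3) K} (hb : b ∈ unitaryGroupOfForm σ ((StdForm.antidiagonal 3).over K))
    (htri : (b : Matrix (Fin 3) (Fin 3) K).BlockTriangular id) :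
    ∃ α β x y c : K, α ≠ 0 ∧ σ β * β = 1 ∧
      (b : Matrix (Fin 3) (Fin 3) K) = Matrix.diagonal ![α, β, (σ α)⁻¹] * !![1, x, y; 0, 1, c; 0, 0, 1] := by
  have h10 : (b : Matrix (Fin 3) (Fin 3) K) 1 0 = 0 := htri (by decide)
  have h20 : (b : Matrix (Fin 3) (Fin 3) K) 2 0 = 0 := htri (by decide)
  have h21 : (b : Matrix (Fin 3) (Fin 3) K) 2 1 = 0 := htri (by decide)
  have hinv := (mem_unitaryGroupOfForm_antidiagonal_iff (σ := σ) (N := 3) b).1 hb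
  -- `σ b₀₀ · b₂₂ = 1` and `σ b₁₁ · b₁₁ = 1`
  have hcol : ∀ j i, ((b : Matrix (Fin 3) (Fin 3) K) *ᵥ (Pi.single j 1 : Fin 3 → K)) i = (b : Matrix (Fin 3) (Fin 3) K) i j :=
    fun j i => by rw [Matrix.mulVec_single_one]; rfl
  have h02 : σ ((b : Matrix (Fin 3) (Fin 3) K) 0 0) * (b : Matrix (Fin 3) (Fin 3) K) 2 2 = 1 := by
    have h := hinv (Pi.single 0 1) (Pi.single 2 1)
    rw [B₀_three_apply, B₀_three_apply] at h
    simpa [hcol, h10, h20] using h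
  have h11 : σ ((b : Matrix (Fin 3) (Fin 3) K) 1 1) * (b : Matrix (Fin 3) (Fin 3) K) 1 1 = 1 := by
    have h := hinv (Pi.single 1 1) (Pi.single 1 1)
    rw [B₀_three_apply, B₀_three_apply] at h
    simpa [hcol, h21] using h
  have hα : (b : Matrix (Fin 3) (Fin 3) K) 0 0 ≠ 0 := fun h0 => by rw [h0, map_zero, zero_mul] at h02; exact zero_ne_one h02
  have h22 : (b : Matrix (Fin 3) (Fin 3) K) 2 2 = (σ ((b : Matrix (Fin 3) (Fin 3) K) 0 0))⁻¹ := (inv_eq_of_mul_eq_one_right h02).symm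
  have hβ : (b : Matrix (Fin 3) (Fin 3) K) 1 1 ≠ 0 := fun h0 => by rw [h0, mul_zero] at h11; exact zero_ne_one h11
  refine ⟨(b : Matrix (Fin 3) (Fin 3) K) 0 0, (b : Matrix (Fin 3) (Fin 3) K) 1 1, ((b : Matrix (Fin 3) (Fin 3) K) 0 0)⁻¹ * (b : Matrix (Fin 3) (Fin 3) K) 0 1,
    ((b : Matrix (Fin 3) (Fin 3) K) 0 0)⁻¹ * (b : Matrix (Fin 3) (Fin 3) K) 0 2, ((b : Matrix (Fin 3) (Fin 3) K) 1 1)⁻¹ * (b : Matrix (Fin 3) (Fin 3) K) 1 2, hα, h11, ?_⟩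
  ext i j
  fin_cases i <;> fin_cases j <;> simp [Matrix.mul_apply, Matrix.diagonal, h10, h20, h21, h22, hα, hβ]

/-! ## §2 Over a discretely valued field: the covering `U = K₀ · d(z)^ℤ · C(n(t))` and the level of `g·n(t)·g⁻¹` -/

section Valued

variable [Valued K ℤᵐ⁰]

/-- A non-zero element has valuation `exp(−j)` for some `j : ℤ`, i.e. `|a| = |z|^j` for `|z| = exp(−1)`. [cite: Serre1979, Ch. II §1] -/
theorem exists_v_eq_v_zpow {z : K} (hz1 : Valued.v z = WithZero.exp (-1 : ℤ)) {a : K} (ha : a ≠ 0) : ∃ j : ℤ, Valued.v a = Valued.v z ^ j := by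
  refine ⟨-WithZero.log (Valued.v a), ?_⟩
  rw [hz1, ← WithZero.exp_zsmul, smul_eq_mul, mul_neg, mul_one, neg_neg, WithZero.exp_log ((Valuation.ne_zero_iff _).2 ha)]

/-- **(T3) THE COVERING `U(σ, J₀) = K₀ · d(z)^ℤ · C(n(t))`** — Iwasawa (★ `exists_eq_unitaryInt_mul_upper`) + the Borel factor: every `g ∈ U(σ, J₀)` is `k · d(z)^j · c` with
`k ∈ U(σ, J₀)` INTEGRAL WITH INTEGRAL INVERSE (`K₀`), `j : ℤ`, and `c ∈ U(σ, J₀)` COMMUTING with `n(t)` (indeed `c = diag(1, β, 1)·n₁`, `n₁ ∈ N`).  Here `z` is a uniformiser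
(`|z| = exp(−1)`, any ramification), `d(z) = diag(z, 1, (σz)⁻¹)`, `n(t) = 1 + t·E₀₂` (no condition on `t`). [cite: Rogawski1990, §3.9 p. 32; §4.5 p. 45] [cite: Rao1972, Thm. p. 505] -/
theorem exists_eq_int_mul_torusElt_zpow_mul_of_commute (hσ : ∀ a : K, σ (σ a) = a) (hvσ : ∀ a, Valued.v (σ a) = Valued.v a)
    {z : K} (hz1 : Valued.v z = WithZero.exp (-1 : ℤ)) {d : GL (Fin 3) K} (hd : (d : Matrix (Fin 3) (Fin 3) K) = Matrix.diagonal ![z, 1, (σ z)⁻¹])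
    {t : K} {u : GL (Fin 3) K} (hu : (u : Matrix (Fin 3) (Fin 3) K) = !![1, 0, t; 0, 1, 0; 0, 0, 1])
    {g : GL (Fin 3) K} (hg : g ∈ unitaryGroupOfForm σ ((StdForm.antidiagonal 3).over K)) :
    ∃ (k : GL (Fin 3) K) (j : ℤ) (c : GL (Fin 3) K), k ∈ unitaryGroupOfForm σ ((StdForm.antidiagonal 3).over K) ∧
      IsIntMatrix (k : Matrix (Fin 3) (Fin 3) K) ∧ IsIntMatrix ((k⁻¹ : GL (Fin 3) K) : Matrix (Fin 3) (Fin 3) K) ∧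
      c ∈ unitaryGroupOfForm σ ((StdForm.antidiagonal 3).over K) ∧ c * u = u * c ∧ g = k * d ^ j * c := by
  have hz : z ≠ 0 := fun h => by rw [h, map_zero] at hz1; exact WithZero.zero_ne_coe hz1
  -- Iwasawa `g = k₀ b` and the Borel factor `b = diag(α, β, (σα)⁻¹)·n₁`
  obtain ⟨k₀, hk₀, b, hbtri, hgb⟩ := exists_eq_unitaryInt_mul_upper hσ hvσ ⟨g, hg⟩
  obtain ⟨α, β, x, y, c, hα, hβ, hbD⟩ := exists_coe_eq_diagonal_mul_upperUnipotent_of_blockTriangular σ b.2 hbtri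
  -- `α = α₀ z^j`, `|α₀| = 1`
  obtain ⟨j, hj⟩ := exists_v_eq_v_zpow hz1 hα
  set α₀ : K := α * (z ^ j)⁻¹ with hα₀_def
  have hzj : z ^ j ≠ 0 := zpow_ne_zero j hz
  have hα₀ : α₀ ≠ 0 := mul_ne_zero hα (inv_ne_zero hzj)
  have hvα₀ : Valued.v α₀ = 1 := by rw [hα₀_def, map_mul, map_inv₀, map_zpow₀, hj, mul_inv_cancel₀ (zpow_ne_zero j ((Valuation.ne_zero_iff _).2 hz))]
  have hαeq : α = α₀ * z ^ j := by rw [hα₀_def, inv_mul_cancel_right₀ hzj]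
  -- the three units `k₁ = d(α₀)`, `m = diag(1, β, 1)`, `n₁`
  obtain ⟨k₁, hk₁, hk₁'⟩ := exists_units_coe_eq_torusElt σ hα₀
  have hβ0 : β ≠ 0 := fun h0 => by rw [h0, mul_zero] at hβ; exact zero_ne_one hβ
  obtain ⟨m, hm, hm'⟩ := exists_units_coe_eq_torusS (K := K) one_ne_zero hβ0
  obtain ⟨n₁, hn₁, -⟩ := exists_units_coe_eq_upperTriangularUnipotent x y c
  -- `b = k₁ · d^j · m · n₁`
  have hσα₀ : σ α₀ ≠ 0 := (map_ne_zero σ).2 hα₀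
  have hσzj : σ (z ^ j) ≠ 0 := (map_ne_zero σ).2 hzj
  have hbprod : (b : GL (Fin 3) K) = k₁ * d ^ j * (m * n₁) := by
    refine Units.ext ?_
    rw [hbD, Units.val_mul, Units.val_mul, Units.val_mul, hk₁, coe_torusElt_zpow σ hz hd j, hm, hn₁, Matrix.diagonal_mul_diagonal, ← Matrix.mul_assoc,
      Matrix.diagonal_mul_diagonal, hαeq, map_mul, map_zpow₀]
    congr 2
    funext i; fin_cases i
    · simp
    · simp
    · simp [mul_comm]
  have hk₁U : k₁ ∈ unitaryGroupOfForm σ ((StdForm.antidiagonal 3).over K) := torusElt_mem_unitaryGroupOfForm σ hα₀ (hσ α₀) hk₁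
  have hdU : d ∈ unitaryGroupOfForm σ ((StdForm.antidiagonal 3).over K) := torusElt_mem_unitaryGroupOfForm σ hz (hσ z) hd
  obtain ⟨hmU, hmc⟩ := diagOneMid_mem_unitaryGroupOfForm_and_commute σ hβ hm hu
  -- `n₁ ∈ U` (all other factors are) and `n₁` commutes with `n(t)`
  have hn₁U : n₁ ∈ unitaryGroupOfForm σ ((StdForm.antidiagonal 3).over K) := by
    have h : n₁ = m⁻¹ * ((d ^ j)⁻¹ * (k₁⁻¹ * (b : GL (Fin 3) K))) := by rw [hbprod]; group
    rw [h]
    exact mul_mem (inv_mem hmU) (mul_mem (inv_mem (zpow_mem hdU j)) (mul_mem (inv_mem hk₁U) b.2))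
  refine ⟨(k₀ : GL (Fin 3) K) * k₁, j, m * n₁, mul_mem k₀.2 hk₁U, ?_, ?_, mul_mem hmU hn₁U, ?_, ?_⟩
  · -- `k₀ k₁` integral
    rw [Units.val_mul]
    refine isIntMatrix_mul (mem_unitaryInt_iff.1 hk₀).1 ?_
    rw [hk₁]; exact isIntMatrix_diagonal_three hvα₀.le (le_of_eq (map_one _)) (by rw [map_inv₀, hvσ, hvα₀, inv_one])
  · -- `(k₀ k₁)⁻¹ = k₁⁻¹ k₀⁻¹` integral
    rw [_root_.mul_inv_rev, Units.val_mul]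
    refine isIntMatrix_mul ?_ ?_
    · rw [hk₁']; exact isIntMatrix_diagonal_three (by rw [map_inv₀, hvα₀, inv_one]) (le_of_eq (map_one _)) (by rw [hvσ, hvα₀])
    · have h := (mem_unitaryInt_iff.1 hk₀).2
      rwa [← Subgroup.coe_inv] at h
  · rw [mul_assoc, mul_eq_mul_of_coe_eq_upperUnipotent hn₁ hu, ← mul_assoc, hmc, mul_assoc]
  · have h : g = ((k₀ * b : unitaryGroupOfForm σ ((StdForm.antidiagonal 3).over K)) : GL (Fin 3) K) := by rw [← hgb]
    rw [h, Subgroup.coe_mul, hbprod]; group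

/-- **(T4) THE LEVEL OF `g·n(t)·g⁻¹` ALONG THE FRAME**: for `g = k · d(z)^j · c` (`k, k⁻¹` integral, `c` commuting with `n(t)`), ALL entries of `g n(t) g⁻¹ − 1` have valuation
`≤ r` iff `|N(z)^j · t| ≤ r` (`N(z) = z·σz`): `g n(t) g⁻¹ = k · n(N(z)^j t) · k⁻¹` ((T2) + `c n(t) c⁻¹ = n(t)`) and `GL₃(𝒪)`-conjugation preserves entry levels (★
`forall_v_conj_sub_one_apply_le_iff`).  With `|t| = exp(−e)`, `|z| = exp(−1)` and `r = exp(−n)` this is the «bounded below» clause `2j + e ≥ n`. [cite: Rogawski1990, §4.9 p. 54] [cite: Rao1972, Thm. p. 505] -/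
theorem forall_v_conj_cornerUnipotent_sub_one_apply_le_iff {z : K} (hz : z ≠ 0) {d : GL (Fin 3) K} (hd : (d : Matrix (Fin 3) (Fin 3) K) = Matrix.diagonal ![z, 1, (σ z)⁻¹])
    {t : K} {u : GL (Fin 3) K} (hu : (u : Matrix (Fin 3) (Fin 3) K) = !![1, 0, t; 0, 1, 0; 0, 0, 1])
    {k c g : GL (Fin 3) K} (hk : IsIntMatrix (k : Matrix (Fin 3) (Fin 3) K)) (hki : IsIntMatrix ((k⁻¹ : GL (Fin 3) K) : Matrix (Fin 3) (Fin 3) K))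
    (hc : c * u = u * c) {j : ℤ} (hg : g = k * d ^ j * c) (r : ℤᵐ⁰) :
    (∀ a b, Valued.v ((((g * u * g⁻¹ : GL (Fin 3) K) : Matrix (Fin 3) (Fin 3) K) - 1) a b) ≤ r) ↔ Valued.v ((z * σ z) ^ j * t) ≤ r := by
  have hguh : g * u * g⁻¹ = k * (d ^ j * u * (d ^ j)⁻¹) * k⁻¹ := by
    rw [hg]
    calc k * d ^ j * c * u * (k * d ^ j * c)⁻¹ = k * d ^ j * (c * u * c⁻¹) * (d ^ j)⁻¹ * k⁻¹ := by group
      _ = k * d ^ j * u * (d ^ j)⁻¹ * k⁻¹ := by rw [hc, mul_inv_cancel_right]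
      _ = k * (d ^ j * u * (d ^ j)⁻¹) * k⁻¹ := by group
  rw [hguh, forall_v_conj_sub_one_apply_le_iff hk hki, coe_torusElt_zpow_conj_cornerUnipotent σ hz hd hu j]
  constructor
  · intro h
    simpa [Matrix.sub_apply] using h 0 2
  · intro h a b
    rw [Matrix.sub_apply]
    fin_cases a <;> fin_cases b <;> first | (simp; done) | simpa using h

end Valued

end Literature.NumberTheory.Automorphic.UnitaryGroup

end
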